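import Summits.CriticalPhenomena.PercolationContinuityZ3.Theses.PercNearOneGluing
import Summits.CriticalPhenomena.PercolationContinuityZ3.Theorems.PercNearOneGluingAdditiveGluingKilledExchange
import Literature.Probability.Percolation.TwoSetConditionalAssociation
import Literature.Probability.Percolation.KozmaNitzanPreFKG
import HarnessLib

/-!
# Crux `PercNearOneGluing.AdditiveGluing` (stmt-CriticalPhenomena-4576), line `tieline` (lead c13):
# stub `stub_threeClusterNegCorr_c13` — the B-step (three-cluster negative correlation)

Support file (`--supports stmt-CriticalPhenomena-4576`, helper): proves exactly the registered stub signature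
`stub_threeClusterNegCorr_c13` of the skeleton of line `tieline` (LeadMath-c13 §3, §5: the B-step of the
covariance-transfer decomposition of the kernel).  No definitions, no named facts, no sorries.

## Content

Weighted graph on `Fin n`, `μ = prodBernoulli w` (Bernoulli bond percolation with arbitrary edge weights on
`BondConfig (Fin n)`), `{x ↔ y} = openConn x y`, `C_v ω = openEdgeCluster ω v` (van den Berg–Häggström–Kahn's
open edge cluster); relays `u, v`, observer `o`, spectator `c`, and an event `A` INCREASING IN `C_v`
(`C_v ω ⊆ C_v ω' → ω ∈ A → ω' ∈ A`).  With `R = {v ↮ u} ∩ {v ↮ c}`: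

`μ(R) · μ(R ∩ A ∩ {o ↔ c}) ≤ μ(R ∩ A) · μ(R ∩ {o ↔ c})`,

i.e. conditionally on `R` the event `A` and the connection `{o ↔ c}` are negatively correlated.

## Proof

`R` is the two-SET separation event `{S ↮ T}` for `S = {v}`, `T = {u, c}`.  Under `{S ↮ T}`,
van den Berg–Häggström–Kahn's Theorem 1.5 with vertex sets (their Theorem 2.1 at `q = 1`, Remark 1 after
Thm. 1.2; tree: `BHK2006_twoSetConditionalAssociation`, event form `guardedTwoClusterExchange` for the pair
`(v, c)`, `v ∈ S`, `c ∈ T`) says that an event closed under enlarging `C_v` (here `A`) and an event closed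
under enlarging `C_c` (here `{c ↔ o}`) are negatively correlated:
`μ(R ∩ (A ∩ {o↔c})) · μ(R) ≤ μ(R ∩ A) · μ(R ∩ {o↔c})`.  This exchange step is already landed, with the
guard written `{u ↮ v} ∩ {v ↮ c}`, as `KilledExchange.exch_event`
(`Theorems/PercNearOneGluingAdditiveGluingKilledExchange.lean`, step (b2) of the killed exchange inequality);
the present file re-brackets it into the registered signature (`{v ↮ u} = {u ↮ v}`, commuting a product,
re-associating an intersection).  No distinctness of `o, u, v, c` is needed (if `v = u` or `v = c` then
`R = ∅` and both sides vanish).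

References: J. van den Berg, O. Häggström, J. Kahn, *Some conditional correlation inequalities for
percolation and related processes*, Random Structures Algorithms 29 (2006) 417–435, Thm. 1.5 (p. 7),
Thm. 2.1 (p. 9), Remark 1 after Thm. 1.2 (p. 5). [cite: VandenbergHaggstromKahn2005, Thm. 1.5 (p. 7)]
-/

namespace Summit.CriticalPhenomena.PercolationContinuityZ3.Cruxes.AdditiveGluing.TieLine

open MeasureTheory Set Literature.Probability.LatticeModels Literature.Probability.Percolation
open Summit.CriticalPhenomena.PercolationContinuityZ3.Theorems

noncomputable section

/-- **B-step (three-cluster negative correlation).** For `A` increasing in `C_v` and `R = {v↮u} ∩ {v↮c}`: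
`μ(R)·μ(R ∩ A ∩ {o↔c}) ≤ μ(R ∩ A)·μ(R ∩ {o↔c})` — conditionally on `v` being joined neither to `u` nor to `c`,
an event increasing in the open cluster of `v` and the connection `{o ↔ c}` are negatively correlated
(van den Berg–Häggström–Kahn, Thm. 1.5 with the vertex sets `{v}`, `{u, c}`; the exchange step is the landed
`KilledExchange.exch_event`). [cite: VandenbergHaggstromKahn2005, Thm. 1.5 (p. 7)] -/
theorem stub_threeClusterNegCorr_c13 : ∀ (n : ℕ) (w : Sym2 (Fin n) → unitInterval) (o u v c : Fin n)
    (A : Set (Literature.Probability.Percolation.BondConfig (Fin n))),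
    (∀ ⦃ω ω' : Literature.Probability.Percolation.BondConfig (Fin n)⦄,
      Literature.Probability.Percolation.openEdgeCluster ω v ⊆ Literature.Probability.Percolation.openEdgeCluster ω' v → ω ∈ A → ω' ∈ A) →
    (Literature.Probability.LatticeModels.prodBernoulli w).real
        ((Literature.Probability.Percolation.openConn v u)ᶜ ∩ (Literature.Probability.Percolation.openConn v c)ᶜ :
          Set (Literature.Probability.Percolation.BondConfig (Fin n))) *
      (Literature.Probability.LatticeModels.prodBernoulli w).real
        ((Literature.Probability.Percolation.openConn v u)ᶜ ∩ (Literature.Probability.Percolation.openConn v c)ᶜ ∩ A ∩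
          Literature.Probability.Percolation.openConn o c : Set (Literature.Probability.Percolation.BondConfig (Fin n))) ≤
    (Literature.Probability.LatticeModels.prodBernoulli w).real
        ((Literature.Probability.Percolation.openConn v u)ᶜ ∩ (Literature.Probability.Percolation.openConn v c)ᶜ ∩ A :
          Set (Literature.Probability.Percolation.BondConfig (Fin n))) *
      (Literature.Probability.LatticeModels.prodBernoulli w).real
        ((Literature.Probability.Percolation.openConn v u)ᶜ ∩ (Literature.Probability.Percolation.openConn v c)ᶜ ∩
          Literature.Probability.Percolation.openConn o c : Set (Literature.Probability.Percolation.BondConfig (Fin n))) := by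
  intro n w o u v c A hA
  -- the landed exchange step (b2) of the killed exchange inequality, guard written `{u↮v} ∩ {v↮c}`
  have key := KilledExchange.exch_event w o u v c hA
  rw [KNPreFKG.openConn_symm u v] at key
  rw [mul_comm, inter_assoc]
  exact key

end

end Summit.CriticalPhenomena.PercolationContinuityZ3.Cruxes.AdditiveGluing.TieLine
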